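import Literature.NumberTheory.LFunctions.DirichletZeroDetector
import Literature.NumberTheory.LFunctions.DirichletLogDerivSegments
import Literature.Analysis.SpecialFunctions.SechSqFourier
import HarnessLib

/-!
# Ford's zero detector for the principal character: `L(s, χ₀) = ζ(s) ∏_{p ∣ q}(1 − p^{−s})`

Topic `Literature/NumberTheory/LFunctions`.  Everything in this file is PROVED (theorems only; no
definition, no named fact).  The finite Euler product `g(s) = ∏_{p ∣ N}(1 − p^{−s})` (Mathlib's factor
in `DirichletCharacter.LFunctionTrivChar_eq_mul_riemannZeta`) is the tree's
`DirichletSegments.eulerFactor N s` (`DirichletLogDerivSegments.lean`), reused here.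

Khale 2024 applies his zero detector Lemma 6.2 to every power `χ^j` of a primitive character,
including the principal character `χ₀` mod `q` (`δ(χ) = 1`), whose `L`-function has a pole at
`s = 1` and the harmless extra zeros of `∏_{p ∣ q}(1 − p^{−s})` on `Re s = 0`.  The tree has Ford's
detector for `ζ` on whole lines with the pole term kept
(`FordZetaDetector.ford_zero_detector_zeta`, `FordZetaZeroDetector.lean`) and for `L(s, χ)`,
`χ ≠ χ₀` (`DirichletDetector.ford_zero_detector_LFunction`).  Here we supply the principal case by
adding to the `ζ` detector the EXACT Jensen identity for the zero-free finite Euler product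
`g(s) = ∏_{p ∣ q}(1 − p^{−s})` in the half-plane `Re s > 0`:

* `PrincipalDetector.neg_re_logDeriv_eulerProd_eq` — for `1/4 ≤ σ − η`, `η > 0` and every `t`,
  `−Re g'/g(σ + it) = (π/8η²)[∫ log|g(σ−η+iy)| k − ∫ log|g(σ+η+iy)| k]`, `k = sech²(π(y−t)/2η)`
  (the rectangle identity `FordDetector.ford_zero_detector_rect` with no zeros, horizontal edges
  receding: `|g'/g| ≤ 7 Σ_{p∣q} log p`, `|log|g|| ≤ 2ω(q)` on `Re ≥ 1/4`);
* `PrincipalDetector.ford_zero_detector_trivChar` — **the detector for `L(s, χ₀)` on whole lines,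
  Ford's parametrisation**: for `t ≠ 0`, `σ ≥ 1`, `η > 0`, `1/2 ≤ σ − η`, `σ + η ≤ 3`, no zero of
  `ζ` on `Re z = σ − η`, and `S` a finite set of zeros of `ζ` with `Re ρ > σ − η`,
  `−Re (L'/L)(s, χ₀) ≤ (σ − 1)/|s − 1|² + Σ_{ρ∈S} m(ρ) Re h_η(ρ − s)`
  `   + (1/4η)[∫ log|L(σ−η+i(t+2ηu/π), χ₀)|/cosh²u du − ∫ log|L(σ+η+i(t+2ηu/π), χ₀)|/cosh²u du]`,
  `m = riemannZetaZeroOrder` (the zeros of `L(·, χ₀)` with `Re ρ > 0` are those of `ζ`, with the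
  same multiplicity).  The first term is the pole's contribution (`≥ 0`, `≈ e^{−πt/η}`, exactly `0`
  at `σ = 1`), which Lemma 6.2 of the source (like Ford's Lemma 4.1) drops silently.

## References

* T. Khale, arXiv:2210.06457v1, Lemma 6.2 (the case `δ(χ) = 1`). [Khale2024]
* K. Ford, *Zero-free regions for the Riemann zeta function* (2002), Lemma 2.2, Lemma 4.1.
  [Ford2002Millennium]
-/

noncomputable section

open Complex Set Metric Filter Topology MeasureTheory Real intervalIntegral
open Literature.Analysis.Complex Literature.Analysis.Complex.FordDetector

namespace Literature.NumberTheory.LFunctions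

namespace PrincipalDetector

variable {N : ℕ}

/-! ### The factors `1 − p^{−s}` -/

/-- `‖p^{−s}‖ ≤ 0.85` for a prime `p` and `Re s ≥ 1/4` (`2^{−1/4} = 0.8409`). [folklore] -/
theorem norm_prime_cpow_neg_le {p : ℕ} (hp : p.Prime) {s : ℂ} (hs : 1 / 4 ≤ s.re) :
    ‖(p : ℂ) ^ (-s)‖ ≤ 0.85 := by
  have hp2 : (2 : ℝ) ≤ p := by exact_mod_cast hp.two_le
  rw [Complex.norm_natCast_cpow_of_pos hp.pos, neg_re]
  calc (p : ℝ) ^ (-s.re) ≤ (2 : ℝ) ^ (-s.re) :=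
        Real.rpow_le_rpow_of_nonpos (by norm_num) hp2 (by linarith)
    _ ≤ (2 : ℝ) ^ (-(1 / 4 : ℝ)) := Real.rpow_le_rpow_of_exponent_le (by norm_num) (by linarith)
    _ ≤ 0.85 := by
        by_contra h
        rw [not_le] at h
        have h4 : (0.85 : ℝ) ^ (4 : ℕ) < ((2 : ℝ) ^ (-(1 / 4 : ℝ))) ^ (4 : ℕ) :=
          pow_lt_pow_left₀ h (by norm_num) (by norm_num)
        have e : ((2 : ℝ) ^ (-(1 / 4 : ℝ))) ^ (4 : ℕ) = 1 / 2 := by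
          rw [← Real.rpow_natCast, ← Real.rpow_mul (by norm_num)]; norm_num
        rw [e] at h4
        norm_num at h4

/-- The factor `1 − p^{−s}` does not vanish for `Re s ≥ 1/4`, and `0.15 ≤ ‖1 − p^{−s}‖ ≤ 2`. [folklore] -/
theorem norm_factor_bounds {p : ℕ} (hp : p.Prime) {s : ℂ} (hs : 1 / 4 ≤ s.re) :
    0.15 ≤ ‖1 - (p : ℂ) ^ (-s)‖ ∧ ‖1 - (p : ℂ) ^ (-s)‖ ≤ 2 := by
  have h := norm_prime_cpow_neg_le hp hs
  constructor
  · have := norm_sub_norm_le (1 : ℂ) ((p : ℂ) ^ (-s))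
    rw [norm_one] at this
    linarith
  · calc ‖1 - (p : ℂ) ^ (-s)‖ ≤ ‖(1 : ℂ)‖ + ‖(p : ℂ) ^ (-s)‖ := norm_sub_le _ _
      _ ≤ 1 + 0.85 := by rw [norm_one]; linarith
      _ ≤ 2 := by norm_num

/-- The factor does not vanish for `Re s ≥ 1/4`. [folklore] -/
theorem factor_ne_zero {p : ℕ} (hp : p.Prime) {s : ℂ} (hs : 1 / 4 ≤ s.re) : 1 - (p : ℂ) ^ (-s) ≠ 0 := by
  have := (norm_factor_bounds hp hs).1
  intro h
  rw [h, norm_zero] at this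
  linarith

/-- Derivative of the factor: `(1 − p^{−s})' = (log p) p^{−s}`. [folklore] -/
theorem hasDerivAt_factor {p : ℕ} (hp : p.Prime) (s : ℂ) :
    HasDerivAt (fun z : ℂ ↦ 1 - (p : ℂ) ^ (-z)) (Complex.log p * (p : ℂ) ^ (-s)) s := by
  have hp0 : (p : ℂ) ≠ 0 := by exact_mod_cast hp.ne_zero
  have h1 : HasDerivAt (fun z : ℂ ↦ (p : ℂ) ^ z) ((p : ℂ) ^ (-s) * Complex.log p) (-s) :=
    (Complex.hasStrictDerivAt_const_cpow (Or.inl hp0)).hasDerivAt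
  have h2 : HasDerivAt (fun z : ℂ ↦ (p : ℂ) ^ (-z)) ((p : ℂ) ^ (-s) * Complex.log p * (-1)) s := by
    have h := h1.comp s (hasDerivAt_neg' s)
    simpa only [Function.comp_def] using h
  exact (h2.const_sub 1).congr_deriv (by ring)

/-- The factor is entire. [folklore] -/
theorem differentiable_factor {p : ℕ} (hp : p.Prime) : Differentiable ℂ fun z : ℂ ↦ 1 - (p : ℂ) ^ (-z) :=
  fun z ↦ (hasDerivAt_factor hp z).differentiableAt

/-- `‖(1 − p^{−s})'/(1 − p^{−s})‖ ≤ 7 log p` for `Re s ≥ 1/4`. [folklore] -/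
theorem norm_logDeriv_factor_le {p : ℕ} (hp : p.Prime) {s : ℂ} (hs : 1 / 4 ≤ s.re) :
    ‖logDeriv (fun z : ℂ ↦ 1 - (p : ℂ) ^ (-z)) s‖ ≤ 7 * Real.log p := by
  rw [logDeriv_apply, (hasDerivAt_factor hp s).deriv, norm_div, norm_mul]
  obtain ⟨hlo, -⟩ := norm_factor_bounds hp hs
  have hcp := norm_prime_cpow_neg_le hp hs
  have hlogp : ‖Complex.log p‖ = Real.log p := by
    rw [show (p : ℂ) = ((p : ℝ) : ℂ) by simp, ← Complex.ofReal_log (by positivity), Complex.norm_real,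
      Real.norm_eq_abs, abs_of_nonneg (Real.log_natCast_nonneg p)]
  have hlog0 : 0 ≤ Real.log (p : ℝ) := Real.log_natCast_nonneg p
  rw [hlogp, div_le_iff₀ (by linarith)]
  nlinarith [norm_nonneg ((p : ℂ) ^ (-s))]

/-- `|log ‖1 − p^{−s}‖| ≤ 2` for `Re s ≥ 1/4`. [folklore] -/
theorem abs_log_norm_factor_le {p : ℕ} (hp : p.Prime) {s : ℂ} (hs : 1 / 4 ≤ s.re) :
    |Real.log ‖1 - (p : ℂ) ^ (-s)‖| ≤ 2 := by
  obtain ⟨hlo, hhi⟩ := norm_factor_bounds hp hs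
  have hpos : 0 < ‖1 - (p : ℂ) ^ (-s)‖ := by linarith
  rw [abs_le]
  constructor
  · -- `log 0.15 ≥ -2`: `e^{-2} ≤ 0.15`
    have h1 : Real.log 0.15 ≤ Real.log ‖1 - (p : ℂ) ^ (-s)‖ := Real.log_le_log (by norm_num) hlo
    have h2 : (-2 : ℝ) ≤ Real.log 0.15 := by
      rw [Real.le_log_iff_exp_le (by norm_num)]
      have := Real.exp_one_gt_d9
      have e : Real.exp (-2) = 1 / (Real.exp 1 * Real.exp 1) := by
        rw [← Real.exp_add, Real.exp_neg]; norm_num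
      rw [e, div_le_iff₀ (by positivity)]
      nlinarith
    linarith
  · have h1 : Real.log ‖1 - (p : ℂ) ^ (-s)‖ ≤ Real.log 2 := Real.log_le_log hpos hhi
    linarith [Real.log_two_lt_d9]

/-! ### The finite Euler product -/

/-- Unfolding of the tree's `DirichletSegments.eulerFactor`. [folklore] -/
theorem eulerFactor_eq_prod (N : ℕ) (s : ℂ) :
    DirichletSegments.eulerFactor N s = ∏ p ∈ N.primeFactors, (1 - (p : ℂ) ^ (-s)) := rfl

/-- `g(s) ≠ 0` for `Re s ≥ 1/4`. [folklore] -/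
theorem eulerProd_ne_zero (N : ℕ) {s : ℂ} (hs : 1 / 4 ≤ s.re) : DirichletSegments.eulerFactor N s ≠ 0 :=
  Finset.prod_ne_zero_iff.2 fun _ hp ↦ factor_ne_zero (Nat.prime_of_mem_primeFactors hp) hs

/-- `‖g'/g(s)‖ ≤ 7 Σ_{p ∣ N} log p` for `Re s ≥ 1/4`. [folklore] -/
theorem norm_logDeriv_eulerProd_le (N : ℕ) {s : ℂ} (hs : 1 / 4 ≤ s.re) :
    ‖deriv (DirichletSegments.eulerFactor N) s / DirichletSegments.eulerFactor N s‖ ≤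
      7 * ∑ p ∈ N.primeFactors, Real.log p := by
  rw [← logDeriv_apply]
  have e : DirichletSegments.eulerFactor N = fun s ↦ ∏ p ∈ N.primeFactors, (fun (p : ℕ) (z : ℂ) ↦ 1 - (p : ℂ) ^ (-z)) p s := by
    funext s; rfl
  rw [e, logDeriv_prod (fun p hp ↦ factor_ne_zero (Nat.prime_of_mem_primeFactors hp) hs)
    (fun p hp ↦ (differentiable_factor (Nat.prime_of_mem_primeFactors hp)).differentiableAt)]
  rw [Finset.mul_sum]
  refine (norm_sum_le _ _).trans (Finset.sum_le_sum fun p hp ↦ ?_)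
  exact norm_logDeriv_factor_le (Nat.prime_of_mem_primeFactors hp) hs

/-- `|log ‖g(s)‖| ≤ 2 ω(N)` for `Re s ≥ 1/4`. [folklore] -/
theorem abs_log_norm_eulerProd_le (N : ℕ) {s : ℂ} (hs : 1 / 4 ≤ s.re) :
    |Real.log ‖DirichletSegments.eulerFactor N s‖| ≤ 2 * N.primeFactors.card := by
  rw [eulerFactor_eq_prod, norm_prod, Real.log_prod]
  · refine (Finset.abs_sum_le_sum_abs _ _).trans ?_
    calc ∑ p ∈ N.primeFactors, |Real.log ‖1 - (p : ℂ) ^ (-s)‖| ≤ ∑ _p ∈ N.primeFactors, (2 : ℝ) :=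
          Finset.sum_le_sum fun p hp ↦ abs_log_norm_factor_le (Nat.prime_of_mem_primeFactors hp) hs
      _ = 2 * N.primeFactors.card := by rw [Finset.sum_const, nsmul_eq_mul]; ring
  · intro p hp
    exact (norm_pos_iff.2 (factor_ne_zero (Nat.prime_of_mem_primeFactors hp) hs)).ne'

/-- `y ↦ log ‖g(x + iy)‖/cosh²(ν(y − t))` is integrable (`x ≥ 1/4`, `ν > 0`). [folklore] -/
theorem integrable_log_norm_eulerProd_div_cosh_sq (N : ℕ) {x : ℝ} (hx : 1 / 4 ≤ x) {ν : ℝ} (hν : 0 < ν) (t : ℝ) :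
    Integrable fun y : ℝ ↦ Real.log ‖DirichletSegments.eulerFactor N (x + y * I)‖ / Real.cosh (ν * (y - t)) ^ 2 := by
  have hcont : Continuous fun y : ℝ ↦ Real.log ‖DirichletSegments.eulerFactor N (x + y * I)‖ := by
    refine ((DirichletSegments.differentiable_eulerFactor N).continuous.comp (by fun_prop)).norm.log fun y ↦ ?_
    exact (norm_pos_iff.2 (eulerProd_ne_zero N (by simp; linarith))).ne'
  have hker : Integrable fun y : ℝ ↦ 1 / Real.cosh (ν * (y - t)) ^ 2 := by
    have h := Literature.Analysis.SpecialFunctions.integrable_inv_cosh_sq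
    have h2 := (h.comp_sub_right (ν * t)).comp_mul_left' hν.ne'
    refine (h2.congr (ae_of_all _ fun y ↦ ?_))
    show 1 / Real.cosh (ν * y - ν * t) ^ 2 = 1 / Real.cosh (ν * (y - t)) ^ 2
    rw [show ν * y - ν * t = ν * (y - t) by ring]
  refine (hker.const_mul (2 * N.primeFactors.card)).mono' ?_ (ae_of_all _ fun y ↦ ?_)
  · exact (hcont.div (by fun_prop) fun y ↦ (pow_pos (Real.cosh_pos _) 2).ne').aestronglyMeasurable
  · have hc : 0 < Real.cosh (ν * (y - t)) ^ 2 := by positivity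
    rw [Real.norm_eq_abs, abs_div, abs_of_pos hc, div_eq_mul_one_div]
    exact mul_le_mul_of_nonneg_right (abs_log_norm_eulerProd_le N (by simp; linarith)) (by positivity)

/-! ### The exact Jensen identity for `g` on whole lines -/

set_option maxHeartbeats 400000 in
/-- **Jensen's formula in a vertical strip for the zero-free Euler product `g`**: for `η > 0`,
`1/4 ≤ σ − η` and every real `t`,
`−Re g'/g(σ + it) = (π/8η²)[∫ log|g(σ−η+iy)| sech²(π(y−t)/2η) dy − ∫ log|g(σ+η+iy)| sech²(π(y−t)/2η) dy]`
(the identity `FordDetector.ford_zero_detector_rect` on `[σ−η, σ+η] × [−n, n]`, `n → ∞`: no zeros,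
the horizontal terms are `≪ 1/sinh²(π(n − |t|)/2η) → 0`). [cite: Ford2002Millennium, Lemma 2.2] -/
theorem neg_re_logDeriv_eulerProd_eq (N : ℕ) {σ t η : ℝ} (hη : 0 < η) (hleft : 1 / 4 ≤ σ - η) :
    -(deriv (DirichletSegments.eulerFactor N) (σ + t * I) / DirichletSegments.eulerFactor N (σ + t * I)).re =
      π / (8 * η ^ 2) *
        ((∫ y : ℝ, Real.log ‖DirichletSegments.eulerFactor N ((σ - η : ℝ) + y * I)‖ / Real.cosh (π / (2 * η) * (y - t)) ^ 2)
          - ∫ y : ℝ, Real.log ‖DirichletSegments.eulerFactor N ((σ + η : ℝ) + y * I)‖ / Real.cosh (π / (2 * η) * (y - t)) ^ 2) := by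
  set s : ℂ := (σ : ℂ) + t * I with hs
  set ν : ℝ := π / (2 * η) with hν
  have hν0 : 0 < ν := by positivity
  have hsre : s.re = σ := by simp [hs]
  have hsim : s.im = t := by simp [hs]
  have hdiff := DirichletSegments.differentiable_eulerFactor N
  have hne : ∀ z : ℂ, σ - η ≤ z.re → DirichletSegments.eulerFactor N z ≠ 0 := fun z hz ↦ eulerProd_ne_zero N (by linarith)
  set C : ℝ := 7 * ∑ p ∈ N.primeFactors, Real.log p with hC
  have hC0 : 0 ≤ C := by
    have : 0 ≤ ∑ p ∈ N.primeFactors, Real.log (p : ℝ) :=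
      Finset.sum_nonneg fun p _ ↦ Real.log_natCast_nonneg p
    positivity
  set G : ℝ → ℝ := fun y ↦ (Real.log ‖DirichletSegments.eulerFactor N ((σ - η : ℝ) + y * I)‖ -
    Real.log ‖DirichletSegments.eulerFactor N ((σ + η : ℝ) + y * I)‖) / Real.cosh (ν * (y - t)) ^ 2 with hG
  have hIL := integrable_log_norm_eulerProd_div_cosh_sq N (x := σ - η) hleft hν0 t
  have hIR := integrable_log_norm_eulerProd_div_cosh_sq N (x := σ + η) (by linarith) hν0 t
  have hGint : Integrable G := by
    refine (hIL.sub hIR).congr (ae_of_all _ fun y ↦ ?_)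
    simp only [hG, Pi.sub_apply, sub_div]
  have hGeq : ∫ y, G y = (∫ y : ℝ, Real.log ‖DirichletSegments.eulerFactor N ((σ - η : ℝ) + y * I)‖ / Real.cosh (ν * (y - t)) ^ 2)
      - ∫ y : ℝ, Real.log ‖DirichletSegments.eulerFactor N ((σ + η : ℝ) + y * I)‖ / Real.cosh (ν * (y - t)) ^ 2 := by
    rw [← integral_sub hIL hIR]
    refine integral_congr_ae (ae_of_all _ fun y ↦ ?_)
    simp only [hG, sub_div]
  -- the rectangle identity at heights `±n`
  have hrect : ∀ n : ℕ, |t| + 2 ≤ (n : ℝ) →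
      -(deriv (DirichletSegments.eulerFactor N) s / DirichletSegments.eulerFactor N s).re =
        π / (8 * η ^ 2) * (∫ y : ℝ in (-(n : ℝ))..n, G y)
        - 1 / (2 * π) * ((fordHorizontalTerm (DirichletSegments.eulerFactor N) η s (σ - η) (σ + η) n).im
            - (fordHorizontalTerm (DirichletSegments.eulerFactor N) η s (σ - η) (σ + η) (-(n : ℝ))).im) := by
    intro n hn
    have hc : -(n : ℝ) < t := by have := neg_abs_le t; linarith
    have hd : t < n := by have := le_abs_self t; linarith
    have h := ford_zero_detector_rect (f := DirichletSegments.eulerFactor N) (x₀ := σ) (y₀ := t) (c := -(n : ℝ)) (d := n) hη hc hd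
      (fun z _ ↦ hdiff.analyticAt z)
      (fun x hx ↦ hne _ (by simp; linarith [hx.1])) (fun x hx ↦ hne _ (by simp; linarith [hx.1]))
      (fun y _ ↦ hne _ (by simp)) (fun y _ ↦ hne _ (by simp; linarith))
      (hne s (by rw [hsre]; linarith))
    have hempty : {ρ : ℂ | DirichletSegments.eulerFactor N ρ = 0 ∧ ρ ∈ Ioo (σ - η) (σ + η) ×ℂ Ioo (-(n : ℝ)) (n : ℝ)} = ∅ := by
      exact Set.eq_empty_of_forall_notMem fun ρ hρ ↦ hne ρ hρ.2.1.1.le hρ.1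
    rw [hempty, finsum_mem_empty, zero_add] at h
    simp only [hG, hν]
    rw [h]
  -- the horizontal terms are exponentially small
  have hhor : ∀ n : ℕ, |t| + 2 ≤ (n : ℝ) → 1 ≤ ν * ((n : ℝ) - |t|) → ∀ y : ℝ, (y = n ∨ y = -(n : ℝ)) →
      ‖fordHorizontalTerm (DirichletSegments.eulerFactor N) η s (σ - η) (σ + η) y‖ ≤
        (2 * η) ^ 2 * C * (ν ^ 2 * (16 * Real.exp (-(2 * (ν * ((n : ℝ) - |t|)))))) := by
    intro n hn hn1 y hy
    have hyabs : |y| = n := by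
      rcases hy with rfl | rfl
      · exact abs_of_nonneg (Nat.cast_nonneg n)
      · rw [abs_neg, abs_of_nonneg (Nat.cast_nonneg n)]
    have hab : σ - η ≤ σ + η := by linarith
    have hM : ∀ x ∈ Icc (σ - η) (σ + η), ‖deriv (DirichletSegments.eulerFactor N) (x + y * I) / DirichletSegments.eulerFactor N (x + y * I)‖ ≤ C :=
      fun x hx ↦ norm_logDeriv_eulerProd_le N (by simp; linarith [hx.1])
    have hF : ∀ x ∈ Icc (σ - η) (σ + η), ContinuousAt (fun z ↦ deriv (DirichletSegments.eulerFactor N) z / DirichletSegments.eulerFactor N z) (x + y * I) :=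
      fun x hx ↦ continuousAt_logDeriv (hdiff.analyticAt _) (hne _ (by simp; linarith [hx.1]))
    have hyt : y ≠ s.im := by
      rw [hsim]; intro h
      have : |t| = n := by rw [← h]; exact hyabs
      linarith
    have H := norm_fordHorizontalTerm_le (f := DirichletSegments.eulerFactor N) (z₀ := s) hη hab hF hM hyt
    rw [hsim, show σ + η - (σ - η) = 2 * η by ring] at H
    refine H.trans (mul_le_mul_of_nonneg_left ?_ (by positivity))
    have hynt : (n : ℝ) - |t| ≤ |y - t| := by
      have := abs_sub_abs_le_abs_sub y t
      rw [hyabs] at this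
      linarith
    exact FordZetaDetector.kernel_edge_decay hν0 hn1 hynt
  -- limits
  set Bc : ℝ := 1 / (2 * π) * 2 * ((2 * η) ^ 2 * C * (ν ^ 2 * (16 * Real.exp (2 * ν * |t|)))) with hBc
  set E : ℕ → ℝ := fun n ↦ Bc * Real.exp (-(2 * ν * n)) with hE
  have hE0 : Tendsto E atTop (𝓝 0) := by
    have h1 : Tendsto (fun n : ℕ ↦ Real.exp (-(2 * ν * n))) atTop (𝓝 0) := by
      have h := Real.tendsto_exp_neg_atTop_nhds_zero.comp
        ((tendsto_natCast_atTop_atTop (R := ℝ)).const_mul_atTop (by positivity : 0 < 2 * ν))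
      exact h.congr fun n ↦ by simp
    have := h1.const_mul Bc
    rw [mul_zero] at this
    exact this
  have hHbound : ∀ᶠ n : ℕ in atTop,
      ‖1 / (2 * π) * ((fordHorizontalTerm (DirichletSegments.eulerFactor N) η s (σ - η) (σ + η) n).im
          - (fordHorizontalTerm (DirichletSegments.eulerFactor N) η s (σ - η) (σ + η) (-(n : ℝ))).im)‖ ≤ E n := by
    have hev1 : ∀ᶠ n : ℕ in atTop, |t| + 2 ≤ (n : ℝ) :=
      tendsto_natCast_atTop_atTop.eventually_ge_atTop _
    have hev2 : ∀ᶠ n : ℕ in atTop, |t| + 1 / ν ≤ (n : ℝ) :=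
      tendsto_natCast_atTop_atTop.eventually_ge_atTop _
    filter_upwards [hev1, hev2] with n hn hn2
    have hn1 : 1 ≤ ν * ((n : ℝ) - |t|) := by
      have : 1 / ν ≤ (n : ℝ) - |t| := by linarith
      have h := mul_le_mul_of_nonneg_left this hν0.le
      rwa [mul_one_div_cancel hν0.ne'] at h
    have Hd := hhor n hn hn1 n (Or.inl rfl)
    have Hc := hhor n hn hn1 (-(n : ℝ)) (Or.inr rfl)
    have hexp : Real.exp (-(2 * (ν * ((n : ℝ) - |t|)))) = Real.exp (2 * ν * |t|) * Real.exp (-(2 * ν * n)) := by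
      rw [← Real.exp_add]; ring_nf
    rw [Real.norm_eq_abs]
    calc |1 / (2 * π) * ((fordHorizontalTerm (DirichletSegments.eulerFactor N) η s (σ - η) (σ + η) n).im
            - (fordHorizontalTerm (DirichletSegments.eulerFactor N) η s (σ - η) (σ + η) (-(n : ℝ))).im)|
        = 1 / (2 * π) * |(fordHorizontalTerm (DirichletSegments.eulerFactor N) η s (σ - η) (σ + η) n).im
            - (fordHorizontalTerm (DirichletSegments.eulerFactor N) η s (σ - η) (σ + η) (-(n : ℝ))).im| := by
          rw [abs_mul, abs_of_pos (by positivity)]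
      _ ≤ 1 / (2 * π) * (‖fordHorizontalTerm (DirichletSegments.eulerFactor N) η s (σ - η) (σ + η) n‖ +
            ‖fordHorizontalTerm (DirichletSegments.eulerFactor N) η s (σ - η) (σ + η) (-(n : ℝ))‖) := by
          refine mul_le_mul_of_nonneg_left ?_ (by positivity)
          exact (abs_sub _ _).trans (add_le_add (abs_im_le_norm _) (abs_im_le_norm _))
      _ ≤ 1 / (2 * π) * (2 * ((2 * η) ^ 2 * C * (ν ^ 2 * (16 * Real.exp (-(2 * (ν * ((n : ℝ) - |t|)))))))) := by
          refine mul_le_mul_of_nonneg_left ?_ (by positivity)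
          linarith
      _ = E n := by simp only [hE, hBc]; rw [hexp]; ring
  have hH0 : Tendsto (fun n : ℕ ↦ 1 / (2 * π) * ((fordHorizontalTerm (DirichletSegments.eulerFactor N) η s (σ - η) (σ + η) n).im
      - (fordHorizontalTerm (DirichletSegments.eulerFactor N) η s (σ - η) (σ + η) (-(n : ℝ))).im)) atTop (𝓝 0) :=
    squeeze_zero_norm' hHbound hE0
  have hJ : Tendsto (fun n : ℕ ↦ ∫ y : ℝ in (-(n : ℝ))..n, G y) atTop (𝓝 (∫ y, G y)) :=
    intervalIntegral_tendsto_integral hGint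
      (tendsto_neg_atTop_atBot.comp tendsto_natCast_atTop_atTop) tendsto_natCast_atTop_atTop
  have hlim : Tendsto (fun n : ℕ ↦ π / (8 * η ^ 2) * (∫ y : ℝ in (-(n : ℝ))..n, G y)
      - 1 / (2 * π) * ((fordHorizontalTerm (DirichletSegments.eulerFactor N) η s (σ - η) (σ + η) n).im
          - (fordHorizontalTerm (DirichletSegments.eulerFactor N) η s (σ - η) (σ + η) (-(n : ℝ))).im)) atTop
      (𝓝 (π / (8 * η ^ 2) * (∫ y, G y) - 0)) :=
    (hJ.const_mul _).sub hH0
  have hconst : ∀ᶠ n : ℕ in atTop, -(deriv (DirichletSegments.eulerFactor N) s / DirichletSegments.eulerFactor N s).re = π / (8 * η ^ 2) * (∫ y : ℝ in (-(n : ℝ))..n, G y)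
      - 1 / (2 * π) * ((fordHorizontalTerm (DirichletSegments.eulerFactor N) η s (σ - η) (σ + η) n).im
          - (fordHorizontalTerm (DirichletSegments.eulerFactor N) η s (σ - η) (σ + η) (-(n : ℝ))).im) := by
    filter_upwards [tendsto_natCast_atTop_atTop.eventually_ge_atTop (|t| + 2)] with n hn
    exact hrect n hn
  have hfin := tendsto_nhds_unique (tendsto_const_nhds.congr' hconst) hlim
  rw [hfin, sub_zero, hGeq]

/-- The identity in Ford's/Khale's parametrisation `y = t + 2ηu/π`:
`−Re g'/g(σ + it) = (1/4η)[∫ log|g(σ−η+i(t+2ηu/π))|/cosh²u du − ∫ log|g(σ+η+i(t+2ηu/π))|/cosh²u du]`.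
[cite: Ford2002Millennium, Lemma 2.2] -/
theorem neg_re_logDeriv_eulerProd_eq_ford (N : ℕ) {σ t η : ℝ} (hη : 0 < η) (hleft : 1 / 4 ≤ σ - η) :
    -(deriv (DirichletSegments.eulerFactor N) (σ + t * I) / DirichletSegments.eulerFactor N (σ + t * I)).re =
      1 / (4 * η) *
        ((∫ u : ℝ, Real.log ‖DirichletSegments.eulerFactor N ((σ - η : ℝ) + ((t + u * (2 * η / π) : ℝ) : ℂ) * I)‖ / Real.cosh u ^ 2)
          - ∫ u : ℝ, Real.log ‖DirichletSegments.eulerFactor N ((σ + η : ℝ) + ((t + u * (2 * η / π) : ℝ) : ℂ) * I)‖ / Real.cosh u ^ 2) := by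
  have h := neg_re_logDeriv_eulerProd_eq N (t := t) hη hleft
  have hν0 : 0 < π / (2 * η) := by positivity
  have hπ : π ≠ 0 := Real.pi_pos.ne'
  rw [FordZetaDetector.integral_div_cosh_sq_comp (fun y ↦ Real.log ‖DirichletSegments.eulerFactor N ((σ - η : ℝ) + y * I)‖) t hν0,
    FordZetaDetector.integral_div_cosh_sq_comp (fun y ↦ Real.log ‖DirichletSegments.eulerFactor N ((σ + η : ℝ) + y * I)‖) t hν0] at h
  have e1 : 1 / (π / (2 * η)) = 2 * η / π := by rw [one_div_div]
  have e2 : π / (8 * η ^ 2) * (2 * η / π) = 1 / (4 * η) := by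
    field_simp; ring
  simp only [e1] at h
  rw [← mul_sub, ← mul_assoc, e2] at h
  exact h

/-! ### The detector for `L(s, χ₀)` -/

/-- `L(s, χ₀ mod q) = g(s) ζ(s)` for `s ≠ 1` (Mathlib). [folklore] -/
theorem LFunctionTrivChar_eq (q : ℕ) [NeZero q] {s : ℂ} (hs : s ≠ 1) :
    DirichletCharacter.LFunctionTrivChar q s = DirichletSegments.eulerFactor q s * riemannZeta s :=
  DirichletCharacter.LFunctionTrivChar_eq_mul_riemannZeta hs

/-- `L'/L(s, χ₀) = g'/g(s) + ζ'/ζ(s)` where `s ≠ 1`, `ζ(s) ≠ 0`, `Re s ≥ 1/4`. [folklore] -/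
theorem logDeriv_trivChar_eq (q : ℕ) [NeZero q] {s : ℂ} (hs : s ≠ 1) (hζ : riemannZeta s ≠ 0)
    (hre : 1 / 4 ≤ s.re) :
    deriv (DirichletCharacter.LFunctionTrivChar q) s / DirichletCharacter.LFunctionTrivChar q s =
      deriv (DirichletSegments.eulerFactor q) s / DirichletSegments.eulerFactor q s
        + deriv riemannZeta s / riemannZeta s := by
  have hev : DirichletCharacter.LFunctionTrivChar q =ᶠ[𝓝 s] fun z ↦ DirichletSegments.eulerFactor q z * riemannZeta z := by
    filter_upwards [isOpen_compl_singleton.mem_nhds hs] with z hz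
    exact LFunctionTrivChar_eq q hz
  rw [hev.deriv_eq, hev.eq_of_nhds]
  have hg := eulerProd_ne_zero q hre
  have hdg : DifferentiableAt ℂ (DirichletSegments.eulerFactor q) s := DirichletSegments.differentiable_eulerFactor q s
  have hdζ : DifferentiableAt ℂ riemannZeta s := differentiableAt_riemannZeta hs
  rw [deriv_fun_mul hdg hdζ]
  field_simp

/-- **Ford's zero detector for `L(s, χ₀)`, principal character modulo `q`, on whole vertical
lines, Ford's parametrisation** (with the pole term kept, cf. `FordZetaZeroDetector.lean`). Let
`s = σ + it`, `t ≠ 0`, `σ ≥ 1`, `η > 0`, `1/2 ≤ σ − η`, `σ + η ≤ 3`, no zero of `ζ` on `Re z = σ − η`,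
and `S` a finite set of zeros of `ζ` (= the zeros of `L(·, χ₀)` in `Re s > 0`) with `Re ρ > σ − η`. Then
`−Re (L'/L)(s, χ₀) ≤ (σ − 1)/|s − 1|² + Σ_{ρ ∈ S} m(ρ) Re h_η(ρ − s)`
`   + (1/4η) [∫ log|L(σ − η + i(t + 2ηu/π), χ₀)|/cosh²u du − ∫ log|L(σ + η + i(t + 2ηu/π), χ₀)|/cosh²u du]`.
[cite: Khale2024, Lemma 6.2 (δ(χ) = 1)] [cite: Ford2002Millennium, Lemma 2.2 and Lemma 4.1] -/
theorem ford_zero_detector_trivChar (q : ℕ) [NeZero q] {σ t η : ℝ} (hη : 0 < η) (hσ : 1 ≤ σ)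
    (hleft : 1 / 2 ≤ σ - η) (hright : σ + η ≤ 3) (ht : t ≠ 0)
    (hgood : ∀ ρ : ℂ, riemannZeta ρ = 0 → ρ.re ≠ σ - η)
    (S : Finset ℂ) (hS : ∀ ρ ∈ S, riemannZeta ρ = 0 ∧ σ - η < ρ.re) :
    -(deriv (DirichletCharacter.LFunctionTrivChar q) (σ + t * I) /
        DirichletCharacter.LFunctionTrivChar q (σ + t * I)).re ≤
      (σ - 1) / ‖(σ : ℂ) + t * I - 1‖ ^ 2
      + (∑ ρ ∈ S, (riemannZetaZeroOrder ρ : ℝ) * (fordCot η (ρ - (σ + t * I))).re)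
      + 1 / (4 * η) *
        ((∫ u : ℝ, Real.log ‖DirichletCharacter.LFunctionTrivChar q
            ((σ - η : ℝ) + ((t + u * (2 * η / π) : ℝ) : ℂ) * I)‖ / Real.cosh u ^ 2)
          - ∫ u : ℝ, Real.log ‖DirichletCharacter.LFunctionTrivChar q
            ((σ + η : ℝ) + ((t + u * (2 * η / π) : ℝ) : ℂ) * I)‖ / Real.cosh u ^ 2) := by
  have hz := FordZetaDetector.ford_zero_detector_zeta hη hσ hleft hright ht hgood S hS
  have hg := neg_re_logDeriv_eulerProd_eq_ford q (σ := σ) (t := t) hη (by linarith)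
  set s : ℂ := (σ : ℂ) + t * I with hs
  have hs1 : s ≠ 1 := by
    intro h1; apply ht; simpa [hs] using congrArg Complex.im h1
  have hζ : riemannZeta s ≠ 0 := riemannZeta_ne_zero_of_one_le_re (by simp [hs]; exact hσ)
  have hL := logDeriv_trivChar_eq q hs1 hζ (by simp [hs]; linarith)
  rw [hL, Complex.add_re, neg_add]
  -- the line integrals: `log|L| = log|g| + log|ζ|` off at most one point
  have ha : 0 < 2 * η / π := by positivity
  have hIζ : ∀ {x : ℝ}, x ∈ Icc (1 / 2 : ℝ) 3 → Integrable fun u : ℝ ↦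
      Real.log ‖riemannZeta ((x : ℂ) + ((t + u * (2 * η / π) : ℝ) : ℂ) * I)‖ / Real.cosh u ^ 2 :=
    fun hx ↦ ZetaLogNormVertical.integrable_log_norm_riemannZeta_ford hx t ha
  have hIg : ∀ {x : ℝ}, 1 / 4 ≤ x → Integrable fun u : ℝ ↦
      Real.log ‖DirichletSegments.eulerFactor q ((x : ℂ) + ((t + u * (2 * η / π) : ℝ) : ℂ) * I)‖ / Real.cosh u ^ 2 := by
    intro x hx
    have G := integrable_log_norm_eulerProd_div_cosh_sq q hx (ν := 1 / (2 * η / π)) (by positivity) t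
    have H := (G.comp_add_right t).comp_mul_right' ha.ne'
    refine H.congr (ae_of_all _ fun u ↦ ?_)
    have e1 : ((u * (2 * η / π) + t : ℝ) : ℂ) = ((t + u * (2 * η / π) : ℝ) : ℂ) := by push_cast; ring
    have e2 : 1 / (2 * η / π) * (u * (2 * η / π) + t - t) = u := by field_simp; ring
    show Real.log ‖DirichletSegments.eulerFactor q (x + ((u * (2 * η / π) + t : ℝ) : ℂ) * I)‖ /
        Real.cosh (1 / (2 * η / π) * (u * (2 * η / π) + t - t)) ^ 2 =
      Real.log ‖DirichletSegments.eulerFactor q (x + ((t + u * (2 * η / π) : ℝ) : ℂ) * I)‖ / Real.cosh u ^ 2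
    rw [e1, e2]
  -- a.e. pointwise identity on a line `Re = x` without zeros of `ζ`
  have hae : ∀ {x : ℝ}, 1 / 4 ≤ x → (∀ y : ℝ, riemannZeta ((x : ℂ) + y * I) ≠ 0) →
      (fun u : ℝ ↦ Real.log ‖DirichletCharacter.LFunctionTrivChar q
          ((x : ℂ) + ((t + u * (2 * η / π) : ℝ) : ℂ) * I)‖ / Real.cosh u ^ 2) =ᵐ[volume]
        fun u ↦ Real.log ‖DirichletSegments.eulerFactor q ((x : ℂ) + ((t + u * (2 * η / π) : ℝ) : ℂ) * I)‖ / Real.cosh u ^ 2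
          + Real.log ‖riemannZeta ((x : ℂ) + ((t + u * (2 * η / π) : ℝ) : ℂ) * I)‖ / Real.cosh u ^ 2 := by
    intro x hx hζx
    -- the only exceptional `u` is the one with `x + i(t + 2ηu/π) = 1`
    have hsub : ({u : ℝ | (x : ℂ) + ((t + u * (2 * η / π) : ℝ) : ℂ) * I = 1}).Subsingleton := by
      intro u hu v hv
      have h1 := congrArg Complex.im hu
      have h2 := congrArg Complex.im hv
      simp at h1 h2
      have : u * (2 * η / π) = v * (2 * η / π) := by linarith
      exact mul_right_cancel₀ ha.ne' this
    have hmeas : volume {u : ℝ | (x : ℂ) + ((t + u * (2 * η / π) : ℝ) : ℂ) * I = 1} = 0 :=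
      hsub.finite.measure_zero volume
    have : ∀ᵐ u : ℝ, (x : ℂ) + ((t + u * (2 * η / π) : ℝ) : ℂ) * I ≠ 1 := by
      rw [ae_iff]; simpa using hmeas
    filter_upwards [this] with u hu
    rw [LFunctionTrivChar_eq q hu, norm_mul, Real.log_mul (norm_ne_zero_iff.2 (eulerProd_ne_zero q (by simp; linarith)))
      (norm_ne_zero_iff.2 (hζx _)), add_div]
  -- left and right lines
  have hζleft : ∀ y : ℝ, riemannZeta (((σ - η : ℝ) : ℂ) + y * I) ≠ 0 := fun y h ↦ hgood _ h (by simp)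
  have hζright : ∀ y : ℝ, riemannZeta (((σ + η : ℝ) : ℂ) + y * I) ≠ 0 := fun y ↦
    riemannZeta_ne_zero_of_one_le_re (by simp; linarith)
  have eL : (∫ u : ℝ, Real.log ‖DirichletCharacter.LFunctionTrivChar q
        ((σ - η : ℝ) + ((t + u * (2 * η / π) : ℝ) : ℂ) * I)‖ / Real.cosh u ^ 2) =
      (∫ u : ℝ, Real.log ‖DirichletSegments.eulerFactor q ((σ - η : ℝ) + ((t + u * (2 * η / π) : ℝ) : ℂ) * I)‖ / Real.cosh u ^ 2)
        + ∫ u : ℝ, Real.log ‖riemannZeta ((σ - η : ℝ) + ((t + u * (2 * η / π) : ℝ) : ℂ) * I)‖ / Real.cosh u ^ 2 := by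
    rw [integral_congr_ae (hae (x := σ - η) (by linarith) hζleft),
      integral_add (hIg (by linarith)) (hIζ ⟨hleft, by linarith⟩)]
  have eR : (∫ u : ℝ, Real.log ‖DirichletCharacter.LFunctionTrivChar q
        ((σ + η : ℝ) + ((t + u * (2 * η / π) : ℝ) : ℂ) * I)‖ / Real.cosh u ^ 2) =
      (∫ u : ℝ, Real.log ‖DirichletSegments.eulerFactor q ((σ + η : ℝ) + ((t + u * (2 * η / π) : ℝ) : ℂ) * I)‖ / Real.cosh u ^ 2)
        + ∫ u : ℝ, Real.log ‖riemannZeta ((σ + η : ℝ) + ((t + u * (2 * η / π) : ℝ) : ℂ) * I)‖ / Real.cosh u ^ 2 := by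
    rw [integral_congr_ae (hae (x := σ + η) (by linarith) hζright),
      integral_add (hIg (by linarith)) (hIζ ⟨by linarith, hright⟩)]
  rw [eL, eR]
  simp only [hs] at hg hz ⊢
  rw [hg]
  linarith [hz]


end PrincipalDetector

end Literature.NumberTheory.LFunctions
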